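import Literature.MathematicalPhysics.QuantumFieldTheory.Balaban1983to89.B9Eq3132CoerciveFromEnergy
import Literature.MathematicalPhysics.QuantumFieldTheory.Balaban1983to89.B9Eq3132TentLassos
import Literature.MathematicalPhysics.QuantumFieldTheory.Balaban1983to89.B9BackgroundsKLevelV1R

/-!
# `Balaban1983to89.B9Eq3132CoerciveFromEnergyR` — T. Bałaban, *Propagators for lattice gauge theories in a background field*, Commun. Math. Phys. **99** (1985)
# 389–434 [Balaban1985BackgroundPropagators], (3.132) p. 422 under Theorem 3.12's prefix p. 423 with Theorem 3.11 p. 416: ROW 26's COERCIVITY `hcoA` OF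
# `Q(U) Δ_a(U)⁻¹ Q*(U)` FROM ROW 17 AND THE TENT ENERGY, RE-PRESSED ONCE OVER THE CLASS-PARAMETRIC CARRIER `bg9YR 𝔸 G R₁ R₂` (CASCADE-R STEP 2, n06-i share;
# the R-twins of `B9Eq3132CoerciveVariational.hcoA_of_testFamily`, `B9Eq3132CoerciveFromEnergy.testFamily_bump ∕ hcoA_of_energy`, and the R-reading of
# `B9Eq3132TentLassos.hP1_of_reg335`)

[4] = T. Bałaban, *Propagators and renormalization transformations for lattice gauge theories. II*, Commun. Math. Phys. **96** (1984) 223–250 [`Balaban1984PropagatorsII`].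

statement-level skeleton of published theorems with citation tags; proofs where landed; nothing here is a claim about the Yang–Mills mass gap

THE PRINT.  [4] (2.147) p. 249 *«⟨λ, QGQ*λ⟩ ≥ γ₀ Σ_y Λ_y²|λ(y)|²»*; [B9] p. 422 (3.132), Theorem 3.11 p. 416 (positivity of `Δ_a(U)` on (3.35)), Theorem 3.12 p. 423
(prefix (3.35), (3.36), α₀ small), p. 396 (3.35) *«U with values in G … |U(∂p) − 1| ≦ …»*, (3.69) p. 404.

WHY THIS FILE (dag-n06-i gen 21; dag-n06-d g12 STEP-3 FACE CENSUS «`s3132Nu_opsYSectE_of_step12` [n06-i]: `bg9Y`-PINNED ✗»; node00-def-Y g23 RULING (α1) and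
per-face rule (c): «a face that READS the class → R-twin with the class fact DISPLAYED as an R-hypothesis, discharged at P by theorems and at Y where it is one»).
The third layer of row 26's supplier chain: `hcoA` (Λ²-coercivity of the normalised `Q(U) T₀(U) Q*(U)`, `T₀ = Δ_a⁻¹`) from ROW 17's positivity clause `hΔA`
and the test family of transported tent bumps.  Two class reads occur: (i) `G`-valuedness `hU.1.1` (trace-symmetry ∕ adjointness of def-Y's letters, (P′2)) —
DISPLAYED as def-Y's `MemOfFam G R₁`; (ii) the CONTENT of (3.35) (plaquette ∕ lasso smallness, my g14 `B9Eq3132TentLassos.hP1_of_reg335` via n06-j's (3.69))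
behind the energy bound (P′1) `hP1` — at generic `R` this bound stays DISPLAYED (`hcoA_of_energy_R`), and §3 discharges it from ONE R-hypothesis `hY`: the
carrier's class at `c35` REFINES MODULE 3's class `(regY335, regY336)` at some constant `c′` (at MODULE 3's families `c′ = c35` and `hY := fun _ _ _ h h' =>
⟨h, h'⟩`; at print's class the intended discharge is dag-n06-j's bridge `B9Eq335ClassBridgePV1.regY335_of_regYP335_ten ∕ regY336_of_regYP336_ten`, `c′ = 10·L³ ∕
10·L⁴`).  Proof texts otherwise verbatim; `coercive_normMatY_of_testOp`, `p2_bump`, `hP1_of_reg335` consumed BY NAME.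

WHAT IS PROVED (sorry-free, 0 def; `𝔸 = M_N(ℂ)`, `G = SU(N)`, basis `trBasis N`).
* §1 ★★ `hcoA_of_testFamily_R (R₁ R₂) (hG : MemOfFam SU(N) R₁) … (T₀) (hT₀) hΔA T hT` — `CoerciveUnder c35 geo (bg9YR … R₁ R₂) (Λ-normalised Q T₀ Q*)` for ANY
  letter `T₀` with `T₀ x U = Ring.inverse (Δ_a(U))` from the carrier-typed `hΔA` and a carrier-typed test family ((P′2), (P′1)).
* §2 `testFamily_bump_R` ((P′2) for the transported bumps from `MemOfFam`, ϑ = ⅞), ★★ `hcoA_of_energy_R (hG) … hΔA hP1` (`hcoA` from `hΔA` + the DISPLAYED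
  carrier-typed energy bound `hP1`).
* §3 ★★ `hP1_R_of_refinesY (hY)` — the carrier-typed `hP1` from `hY : ∀ x α₀ U, R₁ x c35 α₀ U → R₂ x c35 α₀ U → regY335 … x c′ α₀ U ∧ regY336 … x c′ α₀ U`
  (my g14 `hP1_of_reg335 θ M⋆ c′` read at the carrier), ★★★ `hcoA_of_refinesY_R (hG) (hY) … hΔA` (`hcoA` displaying ROW 17's `hΔA` and the refinement only).
* §4 (v1.1) `hP1_R_of_refinesYPos`, ★★★ `hcoA_of_refinesYPos_R` — the same with the refinement GUARDED by `0 < α₀` (the shape dag-n06-j's P-bridge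
  `regY335_of_regYP335 ∕ regY336_of_regYP336` inhabits at print's class with `c′ = 10·L⁴`; it needs `0 ≤ α₀`).

HONEST SCOPE.  Re-typing bookkeeping (CASCADE-R STEP 2) of LANDED derivations; the (3.35)∕(3.36) classes are PARAMETERS; the two class facts used are displayed
hypotheses (`MemOfFam`, and either `hP1` or `hY`); ROW 17's `hΔA` (Theorem 3.11) stays displayed; nothing of [B9] or [4] is asserted; count-neutral; N06 NOT
discharged; one finite 𝕋^{d+1} programme at fixed ε — nothing continuum, nothing OS, nothing about the mass gap.  Cell `pub-ymgap` (HUMAN RULING D-0062), Track A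
node N06 [B9], seat `pub-ymgap-dag-n06-i` (gen 21), 2026-08-28; a NEW file (APPEND-ONLY companion of `B9Eq3132CoerciveVariational` ∕ `…CoerciveFromEnergy` ∕
`…TentLassos`, untouched).
-/

noncomputable section

namespace Literature.MathematicalPhysics.QuantumFieldTheory.Balaban1983to89.B9Eq3132CoerciveFromEnergyR

open Node00
open B6KLevelCensusIndexV1 (KIdx)
open B9PinMembersKLevelV1 (MemberY geo9Y bg9Y)
open B9BackgroundsKLevelV1R (RegFamY bg9YR regY335 regY336 MemOfFam mem_of_reg335R)
open B7Prop2SpecialUnitary (specialUnitaryUnits specialUnitaryUnits_le_unitaryUnits)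
open B9Thm311ReadingCoords (trIP PosDefTr IsSymmTr)
open B9CoReadingCoordsTranspose (TrIdx trBasis trBasis_repr_eq_trace)
open B9Eq3132RingInverseReading (normMatY dimConstY' dimConstY'_pos)
open B9Thm311Curv2Symm (deltaAY_isSymmTr)
open B9Thm311SymmAtRecordV4 (symm0_parSymY adj_parSymY)
open B9Thm311AdjointPairs (isAdjTr_QY_QsY_parBY)
open B9Eq3132NuReading (lamInvY)
open B9Eq3132CTInputs (CoerciveUnder)
open B9Eq3132ScalarIndex (geoComap)
open B9Eq3132TentOperator (tentOp)
open B9Eq3132ApproxRightInverse (bumpProfile p2_bump)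
open B9Eq3132CoerciveVariational (coercive_normMatY_of_testOp)
open B9Eq3132TentLassos (hP1_of_reg335)
open scoped Matrix.Norms.L2Operator

variable {N : ℕ}

/-! ## §1 ★★ `hcoA` from ROW 17's positivity clause and a test family, at the class-parametric carrier -/

section TestFamily

variable (θ : Stage3Params) (Mstar : ℕ) (R₁ R₂ : RegFamY θ.d₆ θ.ℓ₆ θ.hd' θ.hL' θ.b₀ θ.b₁ Mstar (Matrix (Fin N) (Fin N) ℂ))

/-- ★★ **`hcoA` FROM THEOREM 3.11's POSITIVITY OF `Δ_a(U)` AND A TEST FAMILY, AT THE CLASS-PARAMETRIC CARRIER** — the R-twin of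
`B9Eq3132CoerciveVariational.hcoA_of_testFamily` (same proof text; `hΔA` and the test-family estimates premised on the carrier's (3.35)∕(3.36) = `R₁ ∕ R₂`; the
one class read — `G`-valuedness, for the trace-symmetry of `Δ_a(U)` and the adjointness of `Q ∕ Q*` — is the displayed `hG : MemOfFam SU(N) R₁`; the letter is ANY
`T₀` with `T₀ x U = Ring.inverse (Δ_a(U))`, `rfl` at every record's `.GA`): `CoerciveUnder c35 geo (bg9YR … R₁ R₂) (Λ-normalised Q T₀(U) Q*)` with constant
`(1−ϑ)²∕(C·κ′)`. [cite: Balaban1984PropagatorsII, (2.147) p.249; Balaban1985BackgroundPropagators, (3.132) p.422, Thm 3.11 p.416, Thm 3.12 p.423 (prefix), (3.35) p.396, (3.26)–(3.27) p.395, (3.13) p.393] -/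
theorem hcoA_of_testFamily_R (hG : MemOfFam (specialUnitaryUnits (Fin N)) R₁)
    [∀ x : MemberY θ.d₆ θ.ℓ₆ θ.hd' θ.hL' θ.b₀ θ.b₁ Mstar, Fintype (geo9Y x).Site]
    [∀ x : MemberY θ.d₆ θ.ℓ₆ θ.hd' θ.hL' θ.b₀ θ.b₁ Mstar, DecidableEq (geo9Y x).Site] {c35 : ℝ}
    (T₀ : ∀ x : MemberY θ.d₆ θ.ℓ₆ θ.hd' θ.hL' θ.b₀ θ.b₁ Mstar, BondOpY (Matrix (Fin N) (Fin N) ℂ) x.toKIdx)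
    (hT₀ : ∀ (x : MemberY θ.d₆ θ.ℓ₆ θ.hd' θ.hL' θ.b₀ θ.b₁ Mstar) (U : CfgY (Matrix (Fin N) (Fin N) ℂ) x.toKIdx),
      T₀ x U = Ring.inverse (deltaAY x.toKIdx (parSymY x.toKIdx) (parBY x.toKIdx) (GpY x.toKIdx (parSymY x.toKIdx)) U))
    (a311 M311 : ℝ) (ha311 : 0 < a311) (hM311 : 0 < M311)
    (hΔA : ∀ x : MemberY θ.d₆ θ.ℓ₆ θ.hd' θ.hL' θ.b₀ θ.b₁ Mstar, M311 ≤ (geo9Y x).M → ∀ α₀ : ℝ, 0 < α₀ → (geo9Y x).M * α₀ ≤ a311 →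
      ∀ U : (bg9YR (Matrix (Fin N) (Fin N) ℂ) (specialUnitaryUnits (Fin N)) R₁ R₂ x).Cfg,
        (bg9YR (Matrix (Fin N) (Fin N) ℂ) (specialUnitaryUnits (Fin N)) R₁ R₂ x).Reg335 c35 α₀ U →
          PosDefTr (fun _ => (1 : ℝ)) (deltaAY x.toKIdx (parSymY x.toKIdx) (parBY x.toKIdx) (GpY x.toKIdx (parSymY x.toKIdx)) U))
    (T : ∀ x : MemberY θ.d₆ θ.ℓ₆ θ.hd' θ.hL' θ.b₀ θ.b₁ Mstar, CfgY (Matrix (Fin N) (Fin N) ℂ) x.toKIdx →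
      (IBondY x.toKIdx → Matrix (Fin N) (Fin N) ℂ) → (FBondY x.toKIdx → Matrix (Fin N) (Fin N) ℂ))
    (hT : ∃ Mt aT ϑ C : ℝ, 0 < Mt ∧ 0 < aT ∧ ϑ < 1 ∧ 0 < C ∧
      ∀ x : MemberY θ.d₆ θ.ℓ₆ θ.hd' θ.hL' θ.b₀ θ.b₁ Mstar, Mt ≤ (geo9Y x).M → ∀ α₀ : ℝ, 0 < α₀ → (geo9Y x).M * α₀ ≤ aT →
        ∀ U : (bg9YR (Matrix (Fin N) (Fin N) ℂ) (specialUnitaryUnits (Fin N)) R₁ R₂ x).Cfg,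
          (bg9YR (Matrix (Fin N) (Fin N) ℂ) (specialUnitaryUnits (Fin N)) R₁ R₂ x).Reg335 c35 α₀ U →
          (bg9YR (Matrix (Fin N) (Fin N) ℂ) (specialUnitaryUnits (Fin N)) R₁ R₂ x).Reg336 c35 α₀ U →
            (∀ Ψ : IBondY x.toKIdx → Matrix (Fin N) (Fin N) ℂ,
              (1 - ϑ) * trIP (fun _ => (1 : ℝ)) Ψ Ψ ≤ trIP (fun _ => (1 : ℝ)) (QY x.toKIdx (parBY x.toKIdx) U (T x U Ψ)) (fun y => lamInvY x.toKIdx y • Ψ y)) ∧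
            (∀ Ψ : IBondY x.toKIdx → Matrix (Fin N) (Fin N) ℂ,
              trIP (fun _ => (1 : ℝ)) (T x U Ψ) (deltaAY x.toKIdx (parSymY x.toKIdx) (parBY x.toKIdx) (GpY x.toKIdx (parSymY x.toKIdx)) U (T x U Ψ)) ≤
                C * trIP (fun _ => (1 : ℝ)) Ψ Ψ)) :
    CoerciveUnder c35
      (fun x : MemberY θ.d₆ θ.ℓ₆ θ.hd' θ.hL' θ.b₀ θ.b₁ Mstar => geoComap (geo9Y x) (Prod.fst : (geo9Y x).Site × TrIdx N → (geo9Y x).Site))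
      (bg9YR (Matrix (Fin N) (Fin N) ℂ) (specialUnitaryUnits (Fin N)) R₁ R₂)
      (fun x U => normMatY (trBasis N) (lamInvY x.toKIdx) (QGQOfY x.toKIdx (parBY x.toKIdx) (T₀ x) U)) := by
  have hT₀' : T₀ = fun (x : MemberY θ.d₆ θ.ℓ₆ θ.hd' θ.hL' θ.b₀ θ.b₁ Mstar) (U : CfgY (Matrix (Fin N) (Fin N) ℂ) x.toKIdx) =>
      Ring.inverse (deltaAY x.toKIdx (parSymY x.toKIdx) (parBY x.toKIdx) (GpY x.toKIdx (parSymY x.toKIdx)) U) :=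
    funext fun x => funext fun U => hT₀ x U
  subst hT₀'
  obtain ⟨Mt, aT, ϑ, C, hMt, hat, hϑ, hC, hT⟩ := hT
  refine ⟨max M311 Mt, min a311 aT, (1 - ϑ) ^ 2 / (C * dimConstY' (trBasis N)), lt_of_lt_of_le hM311 (le_max_left _ _), lt_min ha311 hat,
    div_pos (by nlinarith) (mul_pos hC (dimConstY'_pos _)), fun x hM α₀ hα₀ hMa U hU hU' => ?_⟩
  have hpos := hΔA x ((le_max_left _ _).trans hM) α₀ hα₀ (hMa.trans (min_le_left _ _)) U hU
  obtain ⟨hP2, hP1⟩ := hT x ((le_max_right _ _).trans hM) α₀ hα₀ (hMa.trans (min_le_right _ _)) U hU hU'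
  -- the ONE class read: `G`-valuedness, from the displayed `MemOfFam SU(N) R₁`
  have hUG : ∀ μ y, U μ y ∈ specialUnitaryUnits (Fin N) := mem_of_reg335R hG x hU
  have hsymm : IsSymmTr (fun _ => (1 : ℝ)) (deltaAY x.toKIdx (parSymY x.toKIdx) (parBY x.toKIdx) (GpY x.toKIdx (parSymY x.toKIdx)) U) :=
    deltaAY_isSymmTr x.toKIdx specialUnitaryUnits_le_unitaryUnits (parSymY x.toKIdx) (parBY x.toKIdx) U hUG
      (fun s s' => parBY_mem x.toKIdx hUG s s') (symm0_parSymY x.toKIdx specialUnitaryUnits_le_unitaryUnits hUG)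
      (adj_parSymY x.toKIdx specialUnitaryUnits_le_unitaryUnits hUG)
  have hadj := isAdjTr_QY_QsY_parBY x.toKIdx specialUnitaryUnits_le_unitaryUnits U hUG
  have key := coercive_normMatY_of_testOp (trBasis N) (trBasis_repr_eq_trace N) _ hsymm hpos _ _ hadj (lamInvY x.toKIdx) (T x U)
    hϑ.le hC hP2 hP1
  -- the goal reads the index bonds as `(geo9Y x).Site` with the family's `Fintype ∕ DecidableEq` instances, `key` with the global ones (equal by
  -- `Subsingleton.elim`, which `convert` discharges); `QGQOfY` IS the composite `Q ∘ G ∘ Qs` by `rfl`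
  beta_reduce
  convert key using 3
  all_goals rfl

/-! ## §2 The transported tent bumps as the test family: (P′2) from `MemOfFam`, (P′1) displayed -/

/-- **(P′2) ∧ (P′1) FOR THE TRANSPORTED BUMPS AT THE CLASS-PARAMETRIC CARRIER, FROM (P′1) ALONE** — the R-twin of `B9Eq3132CoerciveFromEnergy.testFamily_bump`:
(P′2) with `ϑ = ⅞` is `B9Eq3132ApproxRightInverse.p2_bump`, which uses only that `U` is `SU(N)`-valued (`hG : MemOfFam SU(N) R₁`).
[cite: Balaban1984PropagatorsII, (2.147) p.248; Balaban1985BackgroundPropagators, (3.132) p.422, (3.35) p.396] -/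
theorem testFamily_bump_R (hG : MemOfFam (specialUnitaryUnits (Fin N)) R₁) {c35 : ℝ}
    (hP1 : ∃ Mt aT C : ℝ, 0 < Mt ∧ 0 < aT ∧ 0 < C ∧
      ∀ x : MemberY θ.d₆ θ.ℓ₆ θ.hd' θ.hL' θ.b₀ θ.b₁ Mstar, Mt ≤ (geo9Y x).M → ∀ α₀ : ℝ, 0 < α₀ → (geo9Y x).M * α₀ ≤ aT →
        ∀ U : (bg9YR (Matrix (Fin N) (Fin N) ℂ) (specialUnitaryUnits (Fin N)) R₁ R₂ x).Cfg,
          (bg9YR (Matrix (Fin N) (Fin N) ℂ) (specialUnitaryUnits (Fin N)) R₁ R₂ x).Reg335 c35 α₀ U →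
          (bg9YR (Matrix (Fin N) (Fin N) ℂ) (specialUnitaryUnits (Fin N)) R₁ R₂ x).Reg336 c35 α₀ U →
            ∀ Ψ : IBondY x.toKIdx → Matrix (Fin N) (Fin N) ℂ,
              trIP (fun _ => (1 : ℝ)) (tentOp x.toKIdx (bumpProfile x.toKIdx) U Ψ)
                  (deltaAY x.toKIdx (parSymY x.toKIdx) (parBY x.toKIdx) (GpY x.toKIdx (parSymY x.toKIdx)) U (tentOp x.toKIdx (bumpProfile x.toKIdx) U Ψ)) ≤
                C * trIP (fun _ => (1 : ℝ)) Ψ Ψ) :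
    ∃ Mt aT ϑ C : ℝ, 0 < Mt ∧ 0 < aT ∧ ϑ < 1 ∧ 0 < C ∧
      ∀ x : MemberY θ.d₆ θ.ℓ₆ θ.hd' θ.hL' θ.b₀ θ.b₁ Mstar, Mt ≤ (geo9Y x).M → ∀ α₀ : ℝ, 0 < α₀ → (geo9Y x).M * α₀ ≤ aT →
        ∀ U : (bg9YR (Matrix (Fin N) (Fin N) ℂ) (specialUnitaryUnits (Fin N)) R₁ R₂ x).Cfg,
          (bg9YR (Matrix (Fin N) (Fin N) ℂ) (specialUnitaryUnits (Fin N)) R₁ R₂ x).Reg335 c35 α₀ U →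
          (bg9YR (Matrix (Fin N) (Fin N) ℂ) (specialUnitaryUnits (Fin N)) R₁ R₂ x).Reg336 c35 α₀ U →
            (∀ Ψ : IBondY x.toKIdx → Matrix (Fin N) (Fin N) ℂ,
              (1 - ϑ) * trIP (fun _ => (1 : ℝ)) Ψ Ψ ≤
                trIP (fun _ => (1 : ℝ)) (QY x.toKIdx (parBY x.toKIdx) U (tentOp x.toKIdx (bumpProfile x.toKIdx) U Ψ)) (fun y => lamInvY x.toKIdx y • Ψ y)) ∧
            (∀ Ψ : IBondY x.toKIdx → Matrix (Fin N) (Fin N) ℂ,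
              trIP (fun _ => (1 : ℝ)) (tentOp x.toKIdx (bumpProfile x.toKIdx) U Ψ)
                  (deltaAY x.toKIdx (parSymY x.toKIdx) (parBY x.toKIdx) (GpY x.toKIdx (parSymY x.toKIdx)) U (tentOp x.toKIdx (bumpProfile x.toKIdx) U Ψ)) ≤
                C * trIP (fun _ => (1 : ℝ)) Ψ Ψ) := by
  obtain ⟨Mt, aT, C, hMt, haT, hC, hP⟩ := hP1
  exact ⟨Mt, aT, 7 / 8, C, hMt, haT, by norm_num, hC, fun x hM α₀ hα hMa U h335 h336 =>
    ⟨fun Ψ => p2_bump x.toKIdx (mem_of_reg335R hG x h335) Ψ, hP x hM α₀ hα hMa U h335 h336⟩⟩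

/-- ★★ **THE COERCIVITY `hcoA` OF `Q(U) T₀(U) Q*(U)` (`T₀ = Δ_a⁻¹`) FROM ROW 17's `hΔA` AND THE DISPLAYED ENERGY BOUND (P′1), AT THE CLASS-PARAMETRIC CARRIER** —
the R-twin of `B9Eq3132CoerciveFromEnergy.hcoA_of_energy` (letter-generic in `T₀`; `hP1` carrier-typed and displayed; `hG : MemOfFam SU(N) R₁` displayed).
[cite: Balaban1984PropagatorsII, (2.147) p.248; Balaban1985BackgroundPropagators, (3.132) p.422, Thm 3.11 p.416, (3.35) p.396] -/
theorem hcoA_of_energy_R (hG : MemOfFam (specialUnitaryUnits (Fin N)) R₁)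
    [∀ x : MemberY θ.d₆ θ.ℓ₆ θ.hd' θ.hL' θ.b₀ θ.b₁ Mstar, Fintype (geo9Y x).Site]
    [∀ x : MemberY θ.d₆ θ.ℓ₆ θ.hd' θ.hL' θ.b₀ θ.b₁ Mstar, DecidableEq (geo9Y x).Site] {c35 : ℝ}
    (T₀ : ∀ x : MemberY θ.d₆ θ.ℓ₆ θ.hd' θ.hL' θ.b₀ θ.b₁ Mstar, BondOpY (Matrix (Fin N) (Fin N) ℂ) x.toKIdx)
    (hT₀ : ∀ (x : MemberY θ.d₆ θ.ℓ₆ θ.hd' θ.hL' θ.b₀ θ.b₁ Mstar) (U : CfgY (Matrix (Fin N) (Fin N) ℂ) x.toKIdx),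
      T₀ x U = Ring.inverse (deltaAY x.toKIdx (parSymY x.toKIdx) (parBY x.toKIdx) (GpY x.toKIdx (parSymY x.toKIdx)) U))
    (a311 M311 : ℝ) (ha311 : 0 < a311) (hM311 : 0 < M311)
    (hΔA : ∀ x : MemberY θ.d₆ θ.ℓ₆ θ.hd' θ.hL' θ.b₀ θ.b₁ Mstar, M311 ≤ (geo9Y x).M → ∀ α₀ : ℝ, 0 < α₀ → (geo9Y x).M * α₀ ≤ a311 →
      ∀ U : (bg9YR (Matrix (Fin N) (Fin N) ℂ) (specialUnitaryUnits (Fin N)) R₁ R₂ x).Cfg,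
        (bg9YR (Matrix (Fin N) (Fin N) ℂ) (specialUnitaryUnits (Fin N)) R₁ R₂ x).Reg335 c35 α₀ U →
          PosDefTr (fun _ => (1 : ℝ)) (deltaAY x.toKIdx (parSymY x.toKIdx) (parBY x.toKIdx) (GpY x.toKIdx (parSymY x.toKIdx)) U))
    (hP1 : ∃ Mt aT C : ℝ, 0 < Mt ∧ 0 < aT ∧ 0 < C ∧
      ∀ x : MemberY θ.d₆ θ.ℓ₆ θ.hd' θ.hL' θ.b₀ θ.b₁ Mstar, Mt ≤ (geo9Y x).M → ∀ α₀ : ℝ, 0 < α₀ → (geo9Y x).M * α₀ ≤ aT →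
        ∀ U : (bg9YR (Matrix (Fin N) (Fin N) ℂ) (specialUnitaryUnits (Fin N)) R₁ R₂ x).Cfg,
          (bg9YR (Matrix (Fin N) (Fin N) ℂ) (specialUnitaryUnits (Fin N)) R₁ R₂ x).Reg335 c35 α₀ U →
          (bg9YR (Matrix (Fin N) (Fin N) ℂ) (specialUnitaryUnits (Fin N)) R₁ R₂ x).Reg336 c35 α₀ U →
            ∀ Ψ : IBondY x.toKIdx → Matrix (Fin N) (Fin N) ℂ,
              trIP (fun _ => (1 : ℝ)) (tentOp x.toKIdx (bumpProfile x.toKIdx) U Ψ)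
                  (deltaAY x.toKIdx (parSymY x.toKIdx) (parBY x.toKIdx) (GpY x.toKIdx (parSymY x.toKIdx)) U (tentOp x.toKIdx (bumpProfile x.toKIdx) U Ψ)) ≤
                C * trIP (fun _ => (1 : ℝ)) Ψ Ψ) :
    CoerciveUnder c35
      (fun x : MemberY θ.d₆ θ.ℓ₆ θ.hd' θ.hL' θ.b₀ θ.b₁ Mstar => geoComap (geo9Y x) (Prod.fst : (geo9Y x).Site × TrIdx N → (geo9Y x).Site))
      (bg9YR (Matrix (Fin N) (Fin N) ℂ) (specialUnitaryUnits (Fin N)) R₁ R₂)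
      (fun x U => normMatY (trBasis N) (lamInvY x.toKIdx) (QGQOfY x.toKIdx (parBY x.toKIdx) (T₀ x) U)) :=
  hcoA_of_testFamily_R θ Mstar R₁ R₂ hG T₀ hT₀ a311 M311 ha311 hM311 hΔA (fun x U Ψ => tentOp x.toKIdx (bumpProfile x.toKIdx) U Ψ)
    (testFamily_bump_R θ Mstar R₁ R₂ hG hP1)

end TestFamily

/-! ## §3 ★★ The energy bound at the carrier from ONE refinement hypothesis; `hcoA` displaying ROW 17 and the refinement only -/

section Refines

variable (θ : Stage3Params) (Mstar : ℕ) (R₁ R₂ : RegFamY θ.d₆ θ.ℓ₆ θ.hd' θ.hL' θ.b₀ θ.b₁ Mstar (Matrix (Fin N) (Fin N) ℂ))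

/-- ★★ **ROW 26's ENERGY BOUND `hP1` AT THE CLASS-PARAMETRIC CARRIER FROM ONE REFINEMENT HYPOTHESIS**: if the carrier's class at `c35` refines MODULE 3's class at
some constant `c′` — `hY : R₁ x c35 α₀ U → R₂ x c35 α₀ U → regY335 … x c′ α₀ U ∧ regY336 … x c′ α₀ U` (at MODULE 3's families: `c′ = c35`, `⟨h, h'⟩`; at print's
class: dag-n06-j's bridge, `c′ = 10·L³ ∕ 10·L⁴`) — then the `Δ_a(U)`-energy of the transported tent bumps is bounded by `C‖Ψ‖²` uniformly on the carrier's class below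
`M·α₀ ≤ aT`: my g14 `B9Eq3132TentLassos.hP1_of_reg335 θ M⋆ c′` ((3.35)'s plaquette ∕ lasso smallness via (3.69)) read at the carrier (same configurations).
[cite: Balaban1984PropagatorsII, (2.147) p.248; Balaban1985BackgroundPropagators, (3.132) p.422, (3.35)–(3.36) p.396, (3.69) p.404, (3.40) p.397] -/
theorem hP1_R_of_refinesY {c35 c' : ℝ}
    (hY : ∀ (x : MemberY θ.d₆ θ.ℓ₆ θ.hd' θ.hL' θ.b₀ θ.b₁ Mstar) (α₀ : ℝ) (U : CfgY (Matrix (Fin N) (Fin N) ℂ) x.toKIdx),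
      R₁ x c35 α₀ U → R₂ x c35 α₀ U →
        regY335 (Matrix (Fin N) (Fin N) ℂ) (specialUnitaryUnits (Fin N)) x c' α₀ U ∧ regY336 (Matrix (Fin N) (Fin N) ℂ) (specialUnitaryUnits (Fin N)) x c' α₀ U) :
    ∃ Mt aT C : ℝ, 0 < Mt ∧ 0 < aT ∧ 0 < C ∧
      ∀ x : MemberY θ.d₆ θ.ℓ₆ θ.hd' θ.hL' θ.b₀ θ.b₁ Mstar, Mt ≤ (geo9Y x).M → ∀ α₀ : ℝ, 0 < α₀ → (geo9Y x).M * α₀ ≤ aT →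
        ∀ U : (bg9YR (Matrix (Fin N) (Fin N) ℂ) (specialUnitaryUnits (Fin N)) R₁ R₂ x).Cfg,
          (bg9YR (Matrix (Fin N) (Fin N) ℂ) (specialUnitaryUnits (Fin N)) R₁ R₂ x).Reg335 c35 α₀ U →
          (bg9YR (Matrix (Fin N) (Fin N) ℂ) (specialUnitaryUnits (Fin N)) R₁ R₂ x).Reg336 c35 α₀ U →
            ∀ Ψ : IBondY x.toKIdx → Matrix (Fin N) (Fin N) ℂ,
              trIP (fun _ => (1 : ℝ)) (tentOp x.toKIdx (bumpProfile x.toKIdx) U Ψ)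
                  (deltaAY x.toKIdx (parSymY x.toKIdx) (parBY x.toKIdx) (GpY x.toKIdx (parSymY x.toKIdx)) U (tentOp x.toKIdx (bumpProfile x.toKIdx) U Ψ)) ≤
                C * trIP (fun _ => (1 : ℝ)) Ψ Ψ := by
  obtain ⟨Mt, aT, C, hMt, haT, hC, hP⟩ := hP1_of_reg335 (N := N) θ Mstar c'
  exact ⟨Mt, aT, C, hMt, haT, hC, fun x hM α₀ hα hMa U h335 h336 =>
    hP x hM α₀ hα hMa U (hY x α₀ U h335 h336).1 (hY x α₀ U h335 h336).2⟩

/-- ★★★ **THE COERCIVITY `hcoA` AT THE CLASS-PARAMETRIC CARRIER, DISPLAYING ROW 17's `hΔA` AND THE TWO CLASS HYPOTHESES ONLY** (`hG : MemOfFam SU(N) R₁`,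
`hY` = refinement of MODULE 3's class at some `c′`): `hcoA_of_energy_R` with `hP1 := hP1_R_of_refinesY hY`.  At MODULE 3's families (`R₁ = regY335`, `R₂ = regY336`,
`hG := memOfFam_regY335`, `hY := fun _ _ _ h h' => ⟨h, h'⟩`) this is `B9Eq3132FacesAtLetters.hcoA_of_energy_of … (hP1_of_reg335 …)` read at the carrier.
[cite: Balaban1984PropagatorsII, (2.147) p.248; Balaban1985BackgroundPropagators, (3.132) p.422, Thm 3.11 p.416, (3.35)–(3.36) p.396, (3.69) p.404] -/
theorem hcoA_of_refinesY_R (hG : MemOfFam (specialUnitaryUnits (Fin N)) R₁)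
    [∀ x : MemberY θ.d₆ θ.ℓ₆ θ.hd' θ.hL' θ.b₀ θ.b₁ Mstar, Fintype (geo9Y x).Site]
    [∀ x : MemberY θ.d₆ θ.ℓ₆ θ.hd' θ.hL' θ.b₀ θ.b₁ Mstar, DecidableEq (geo9Y x).Site] {c35 c' : ℝ}
    (hY : ∀ (x : MemberY θ.d₆ θ.ℓ₆ θ.hd' θ.hL' θ.b₀ θ.b₁ Mstar) (α₀ : ℝ) (U : CfgY (Matrix (Fin N) (Fin N) ℂ) x.toKIdx),
      R₁ x c35 α₀ U → R₂ x c35 α₀ U →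
        regY335 (Matrix (Fin N) (Fin N) ℂ) (specialUnitaryUnits (Fin N)) x c' α₀ U ∧ regY336 (Matrix (Fin N) (Fin N) ℂ) (specialUnitaryUnits (Fin N)) x c' α₀ U)
    (T₀ : ∀ x : MemberY θ.d₆ θ.ℓ₆ θ.hd' θ.hL' θ.b₀ θ.b₁ Mstar, BondOpY (Matrix (Fin N) (Fin N) ℂ) x.toKIdx)
    (hT₀ : ∀ (x : MemberY θ.d₆ θ.ℓ₆ θ.hd' θ.hL' θ.b₀ θ.b₁ Mstar) (U : CfgY (Matrix (Fin N) (Fin N) ℂ) x.toKIdx),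
      T₀ x U = Ring.inverse (deltaAY x.toKIdx (parSymY x.toKIdx) (parBY x.toKIdx) (GpY x.toKIdx (parSymY x.toKIdx)) U))
    (a311 M311 : ℝ) (ha311 : 0 < a311) (hM311 : 0 < M311)
    (hΔA : ∀ x : MemberY θ.d₆ θ.ℓ₆ θ.hd' θ.hL' θ.b₀ θ.b₁ Mstar, M311 ≤ (geo9Y x).M → ∀ α₀ : ℝ, 0 < α₀ → (geo9Y x).M * α₀ ≤ a311 →
      ∀ U : (bg9YR (Matrix (Fin N) (Fin N) ℂ) (specialUnitaryUnits (Fin N)) R₁ R₂ x).Cfg,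
        (bg9YR (Matrix (Fin N) (Fin N) ℂ) (specialUnitaryUnits (Fin N)) R₁ R₂ x).Reg335 c35 α₀ U →
          PosDefTr (fun _ => (1 : ℝ)) (deltaAY x.toKIdx (parSymY x.toKIdx) (parBY x.toKIdx) (GpY x.toKIdx (parSymY x.toKIdx)) U)) :
    CoerciveUnder c35
      (fun x : MemberY θ.d₆ θ.ℓ₆ θ.hd' θ.hL' θ.b₀ θ.b₁ Mstar => geoComap (geo9Y x) (Prod.fst : (geo9Y x).Site × TrIdx N → (geo9Y x).Site))
      (bg9YR (Matrix (Fin N) (Fin N) ℂ) (specialUnitaryUnits (Fin N)) R₁ R₂)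
      (fun x U => normMatY (trBasis N) (lamInvY x.toKIdx) (QGQOfY x.toKIdx (parBY x.toKIdx) (T₀ x) U)) :=
  hcoA_of_energy_R θ Mstar R₁ R₂ hG T₀ hT₀ a311 M311 ha311 hM311 hΔA (hP1_R_of_refinesY θ Mstar R₁ R₂ hY)

end Refines

/-! ## §4 (v1.1, appended) The refinement hypothesis GUARDED by `0 < α₀` — the shape dag-n06-j's P-bridge inhabits -/

section RefinesPos

variable (θ : Stage3Params) (Mstar : ℕ) (R₁ R₂ : RegFamY θ.d₆ θ.ℓ₆ θ.hd' θ.hL' θ.b₀ θ.b₁ Mstar (Matrix (Fin N) (Fin N) ℂ))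

/-- ★★ **ROW 26's ENERGY BOUND `hP1` AT THE CARRIER FROM THE `α₀`-GUARDED REFINEMENT** (v1.1): as `hP1_R_of_refinesY`, the refinement asked only for
`0 < α₀` — `hY : ∀ x α₀ U, 0 < α₀ → R₁ x c35 α₀ U → R₂ x c35 α₀ U → regY335 … x c′ α₀ U ∧ regY336 … x c′ α₀ U`; this is the shape dag-n06-j's bridge
`B9Eq335ClassBridgePV1.regY335_of_regYP335 ∕ regY336_of_regYP336` (which needs `0 ≤ α₀`) inhabits at print's class with ONE constant `c′ = 10·L⁴`
(`10·L³ ≤ 10·L⁴` serves the (3.35) half); at MODULE 3's families `fun _ _ _ _ h h' => ⟨h, h'⟩`.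
[cite: Balaban1984PropagatorsII, (2.147) p.248; Balaban1985BackgroundPropagators, (3.132) p.422, (3.35)–(3.36) p.396 («≧ 10»), (3.69) p.404] -/
theorem hP1_R_of_refinesYPos {c35 c' : ℝ}
    (hY : ∀ (x : MemberY θ.d₆ θ.ℓ₆ θ.hd' θ.hL' θ.b₀ θ.b₁ Mstar) (α₀ : ℝ) (U : CfgY (Matrix (Fin N) (Fin N) ℂ) x.toKIdx), 0 < α₀ →
      R₁ x c35 α₀ U → R₂ x c35 α₀ U →
        regY335 (Matrix (Fin N) (Fin N) ℂ) (specialUnitaryUnits (Fin N)) x c' α₀ U ∧ regY336 (Matrix (Fin N) (Fin N) ℂ) (specialUnitaryUnits (Fin N)) x c' α₀ U) :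
    ∃ Mt aT C : ℝ, 0 < Mt ∧ 0 < aT ∧ 0 < C ∧
      ∀ x : MemberY θ.d₆ θ.ℓ₆ θ.hd' θ.hL' θ.b₀ θ.b₁ Mstar, Mt ≤ (geo9Y x).M → ∀ α₀ : ℝ, 0 < α₀ → (geo9Y x).M * α₀ ≤ aT →
        ∀ U : (bg9YR (Matrix (Fin N) (Fin N) ℂ) (specialUnitaryUnits (Fin N)) R₁ R₂ x).Cfg,
          (bg9YR (Matrix (Fin N) (Fin N) ℂ) (specialUnitaryUnits (Fin N)) R₁ R₂ x).Reg335 c35 α₀ U →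
          (bg9YR (Matrix (Fin N) (Fin N) ℂ) (specialUnitaryUnits (Fin N)) R₁ R₂ x).Reg336 c35 α₀ U →
            ∀ Ψ : IBondY x.toKIdx → Matrix (Fin N) (Fin N) ℂ,
              trIP (fun _ => (1 : ℝ)) (tentOp x.toKIdx (bumpProfile x.toKIdx) U Ψ)
                  (deltaAY x.toKIdx (parSymY x.toKIdx) (parBY x.toKIdx) (GpY x.toKIdx (parSymY x.toKIdx)) U (tentOp x.toKIdx (bumpProfile x.toKIdx) U Ψ)) ≤
                C * trIP (fun _ => (1 : ℝ)) Ψ Ψ := by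
  obtain ⟨Mt, aT, C, hMt, haT, hC, hP⟩ := hP1_of_reg335 (N := N) θ Mstar c'
  exact ⟨Mt, aT, C, hMt, haT, hC, fun x hM α₀ hα hMa U h335 h336 =>
    hP x hM α₀ hα hMa U (hY x α₀ U hα h335 h336).1 (hY x α₀ U hα h335 h336).2⟩

/-- ★★★ **THE COERCIVITY `hcoA` AT THE CARRIER FROM ROW 17's `hΔA`, `hG : MemOfFam SU(N) R₁` AND THE `α₀`-GUARDED REFINEMENT** (v1.1): `hcoA_of_energy_R` with
`hP1 := hP1_R_of_refinesYPos hY`. [cite: Balaban1984PropagatorsII, (2.147) p.248; Balaban1985BackgroundPropagators, (3.132) p.422, Thm 3.11 p.416, (3.35)–(3.36) p.396, (3.69) p.404] -/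
theorem hcoA_of_refinesYPos_R (hG : MemOfFam (specialUnitaryUnits (Fin N)) R₁)
    [∀ x : MemberY θ.d₆ θ.ℓ₆ θ.hd' θ.hL' θ.b₀ θ.b₁ Mstar, Fintype (geo9Y x).Site]
    [∀ x : MemberY θ.d₆ θ.ℓ₆ θ.hd' θ.hL' θ.b₀ θ.b₁ Mstar, DecidableEq (geo9Y x).Site] {c35 c' : ℝ}
    (hY : ∀ (x : MemberY θ.d₆ θ.ℓ₆ θ.hd' θ.hL' θ.b₀ θ.b₁ Mstar) (α₀ : ℝ) (U : CfgY (Matrix (Fin N) (Fin N) ℂ) x.toKIdx), 0 < α₀ →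
      R₁ x c35 α₀ U → R₂ x c35 α₀ U →
        regY335 (Matrix (Fin N) (Fin N) ℂ) (specialUnitaryUnits (Fin N)) x c' α₀ U ∧ regY336 (Matrix (Fin N) (Fin N) ℂ) (specialUnitaryUnits (Fin N)) x c' α₀ U)
    (T₀ : ∀ x : MemberY θ.d₆ θ.ℓ₆ θ.hd' θ.hL' θ.b₀ θ.b₁ Mstar, BondOpY (Matrix (Fin N) (Fin N) ℂ) x.toKIdx)
    (hT₀ : ∀ (x : MemberY θ.d₆ θ.ℓ₆ θ.hd' θ.hL' θ.b₀ θ.b₁ Mstar) (U : CfgY (Matrix (Fin N) (Fin N) ℂ) x.toKIdx),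
      T₀ x U = Ring.inverse (deltaAY x.toKIdx (parSymY x.toKIdx) (parBY x.toKIdx) (GpY x.toKIdx (parSymY x.toKIdx)) U))
    (a311 M311 : ℝ) (ha311 : 0 < a311) (hM311 : 0 < M311)
    (hΔA : ∀ x : MemberY θ.d₆ θ.ℓ₆ θ.hd' θ.hL' θ.b₀ θ.b₁ Mstar, M311 ≤ (geo9Y x).M → ∀ α₀ : ℝ, 0 < α₀ → (geo9Y x).M * α₀ ≤ a311 →
      ∀ U : (bg9YR (Matrix (Fin N) (Fin N) ℂ) (specialUnitaryUnits (Fin N)) R₁ R₂ x).Cfg,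
        (bg9YR (Matrix (Fin N) (Fin N) ℂ) (specialUnitaryUnits (Fin N)) R₁ R₂ x).Reg335 c35 α₀ U →
          PosDefTr (fun _ => (1 : ℝ)) (deltaAY x.toKIdx (parSymY x.toKIdx) (parBY x.toKIdx) (GpY x.toKIdx (parSymY x.toKIdx)) U)) :
    CoerciveUnder c35
      (fun x : MemberY θ.d₆ θ.ℓ₆ θ.hd' θ.hL' θ.b₀ θ.b₁ Mstar => geoComap (geo9Y x) (Prod.fst : (geo9Y x).Site × TrIdx N → (geo9Y x).Site))
      (bg9YR (Matrix (Fin N) (Fin N) ℂ) (specialUnitaryUnits (Fin N)) R₁ R₂)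
      (fun x U => normMatY (trBasis N) (lamInvY x.toKIdx) (QGQOfY x.toKIdx (parBY x.toKIdx) (T₀ x) U)) :=
  hcoA_of_energy_R θ Mstar R₁ R₂ hG T₀ hT₀ a311 M311 ha311 hM311 hΔA (hP1_R_of_refinesYPos θ Mstar R₁ R₂ hY)

end RefinesPos

end Literature.MathematicalPhysics.QuantumFieldTheory.Balaban1983to89.B9Eq3132CoerciveFromEnergyR

end
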